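import Summits.QuantumFields.YangMills.Theorems.UnitScaleTiltProp7GreenOneSupRowsOfLetters
import Summits.QuantumFields.YangMills.Theorems.UnitScaleTiltProp7FrakGSupRowsOfWords
import HarnessLib

/-!
# Route `UnitScaleTilt`, crux K1 «MinimiserStabilityRegPr» (stmt-QuantumFields-19200), EX row `norm_G` (S47 ✓p766895), NORM_G ROAD (★p1 g27 CHAIR WORDs №24∕№28∕№31∕№33) —
# **(∇1)-KNIT: THE (115)-GRADIENT ROW OF `G₁ = (Pᴾ†(Δ^η + T_J)Pᴾ + DR_SD* + Q_k†aQ_k)⁻¹` IS LINEAR OVER THE SIX-TERM IDENTITY** — the 𝔊-door's letter `hG1` (✓`Prop7FrakGSupRowsOfWords`)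
# from the VALUE∕DIVERGENCE rows (V1)∕(Div1) of `G₁`, the scalar-storey letters (c1)(c2)(c3), the two `T_J` rows (tJ)(tJd), and TWO displayed gradient letters: (∇0) the (115)-gradient
# row of `G₀`, and (H∇) the Hessian row of the chain potential `λ = G′ᴾR_SG′ᴾ(jj)`.  No fixpoint, no window.

Cell `ym3-torus` (HUMAN RULING D-0037; rung R3 = SU(2) YM₃ on T³ — NOT d = 4, NOT infinite volume, NOT a mass gap, NOT Clay).  Width seat `ym3-torus-px17` (gen 12); the (∇)-twin of this
lineage's ✓p770606 (O-G1).  THEOREMS ONLY (0 `def`, 0 `sorry`, default heartbeats); `--supports stmt-QuantumFields-19200 --as helper`; count-neutral.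

WHY.  `norm_G` = `max (VALUE) (∇)` of `𝔊 = PᴾG₁ − H₁Q_kG₁` (N1 ✓p768493, N2 ✓p768265, the door ✓p769750); the door's (∇) letter list is {(∇1) `hG1` = the (115)-gradient row of `G₁`, (Hess3), (H∇ of H₁),
(Qrow), (V1)}.  By ✓`Prop7GreenOneSupRowsOfLetters.GT_one_eq_six_terms` ([Balaban1985BackgroundPropagators] (3.128)–(3.138) expanded),
`G₁f = G₀f + G₀(Δ^η(Dλ₁)) + (Dλ₂ − G₀(Δ^η(Dλ₂))) − G₀(T_J(Pᴾu)) + (Dλ₃ − G₀(Δ^η(Dλ₃)))`, `u = G₁f`, `λ₁ = G′ᴾR_S(D*u)`, `λ₂ = G′ᴾR_SG′ᴾ(D*Δ^η(Pᴾu))`, `λ₃ = G′ᴾR_SG′ᴾ(D*T_J(Pᴾu))`,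
and `∇_{U₀} = nabla115 η (bgOfCfg U₀)` is LINEAR — so `∇(G₁f)` is a signed sum of seven gradients: five `∇G₀(source)` and two `∇Dλ` with `λ` a chain potential.  Once (V1)∕(Div1) are
INPUTS (`‖toL2⁻¹u‖_∞ ≤ BV₁‖A‖`, `‖toL2S⁻¹(D*u)‖_∞ ≤ BD₁‖A‖`), every source is sup-bounded LINEARLY in `‖A‖` by exactly O-G1's intermediate rows ((c1)(c2)(c3), (tJ)(tJd), (C-val)
✓`norm_symm_DeltaEta_DL2_toL2S_apply_le_of_sup` `4α`, (C-div) ✓`norm_symm_DstarL2_DeltaEta_toL2_apply_le` `12α`, `R_SR_S = R_S`), and the two gradient letters finish: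
`BG₁ = BG·(1 + 4αC₁BD₁ + (4αC₁C₃(12α + C_TD) + C_T)(BV₁ + C₂BD₁)) + BH·(12α + C_TD)(BV₁ + C₂BD₁)`.

WHAT IS PROVED (ns `Summit.QuantumFields.YangMills.Theorems.Prop7GreenOneGradientRowOfLetters`; member `F`, `h : n ≤ K`, weights `c₀ cB`, coupling `0 ≤ a`, ANY `T_J` letter `TJ`, background
`U₀` with `RegPr F n K α U₀` on the classes `hp₀`∕`hp₁` at the slots `Δ^η` and `Δ₁ = Pᴾ†(Δ^η + T_J)Pᴾ`).
* §0 `norm_seven_le` — the abstract triangle inequality for the signed seven-term sum.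
* §1 `exists_gradReader` — the gradient reader `y ↦ ∇_{U₀}(toL2⁻¹y ∘ bondEquiv⁻¹)` IS a `ℂ`-linear map (by `rfl`), so it splits sums.
* §2 ★★★ `gradient_row_GTone_of_letters` — THE DOOR's `hG1` TEXT: `∀ A, ‖nabla115 ((L⁻¹)^(K−n)) (bgOfCfg F K U₀) (toL2⁻¹(G₁(toL2 A)) ∘ bondEquiv⁻¹)‖ ≤ BG₁·‖A‖` from (V1)(Div1)(c1)(c2)(c3)(tJ)(tJd)(∇0)(H∇).
* §3 E2E through the door with `hG1` DISCHARGED: ★★ `gradient_row_frakGT_of_letters` (✓p769750 §3: the (∇) letter of `𝔊`, `M_∇ = BG₁ + M₃ + B_HG·BQ·BV₁`) and ★★★ `norm_frakGfR_le_of_letters`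
  (✓p769750 §5: `‖frakGfR … (DeltaOneP T_J) U₀ f‖ ≤ max M_V M_∇ · ‖f‖`, `M_V = BV₁ + C₂·BD₁ + B_H·BQ·BV₁`) — so `norm_G ⟸ norm_H₁ ∧ (V1)(Div1) ∧ (c1)(c2)(c3) ∧ (tJ)(tJd) ∧ (Qrow) ∧ (∇0) ∧ (H∇) ∧ (Hess3)`.
HYP-SAT (★★OWNER RULING №42): `RegPr F n K α U₀` (EX's class; `α` enters only through (C-val)∕(C-div)), `0 ≤ a`, `hp₀`∕`hp₁` ⟸ (γ) ✓p767766 ∕ the J-slot road; (V1)∕(Div1) ⟸ ✓p770606 (`BV₁ = BD₁ = 2(BV+BD)`);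
(c1)(c2)(c3) ⟸ px5's (c)-package (texts VERBATIM = O-G1's); (tJ) ⟸ ✓`norm_TJP_apply_le_of_columns`; (tJd) ⟸ ✓p768852 TJ-DIV; (∇0) ⟸ px5 N5′ ✓`norm_nabla115_bgOfCfg_le_of_letters'` at
`DeltaEtaSlot` fed by N4 (V), the `h349` kernel row and the `Q`-rows (the (∇0)-KNIT; same class as the booked `hGπ`); (H∇) ⟸ HESS-T1 ✓p768631 at `ψ := G′ᴾR_SG′ᴾ(toL2S v) ∈ N_S`
(✓`GprimeP_RS_mem_NS`, `Δ^ηψ = R_SG′ᴾ(toL2S v)` ✓`covLapSite_GprimeP_RS`) with `M_ψ ⟸ (c1)∘(c3)`, `M_φ ⟸ (c3)`, `M_E ⟸ (C-val)`, `G_φ` ⟸ the P4a gradient-row class (the (H∇)-KNIT).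
All letters are linear sup rows; conclusions non-vacuous; no `Prop` placeholder.
HONEST SCOPE.  Bookkeeping (triangle inequalities over a landed identity); no estimate of print is proved here; nothing of the letters, `norm_G`, `norm_H₁`, the eight EX print rows, `hThm2S`,
EX `stub_existenceMinimalOrbit`, `MinimiserStabilityRegPr` (19200) or R3 is proved; the Yang–Mills mass gap is NOT proved.

References: T. Bałaban, CMP **99** (1985) 389–434 [Balaban1985BackgroundPropagators] ((3.3) p.391, (3.117)–(3.119) p.419, (3.128)–(3.131) pp.421–422, (3.134)–(3.138) pp.422–423,
Thm 3.1 (3.42)–(3.45) pp.397–398, Thm 3.12 p.423, (3.152)–(3.153) p.426, Thm 3.13 p.426); CMP **102** (1985) 277–309 [Balaban1985Variational] ((19) p.281, (110)–(111) p.294, (115)–(117) pp.294–295).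
-/

set_option autoImplicit false

noncomputable section

open scoped BigOperators Matrix.Norms.L2Operator InnerProductSpace ComplexConjugate

namespace Summit.QuantumFields.YangMills.Theorems.Prop7GreenOneGradientRowOfLetters

open Literature.MathematicalPhysics.QuantumFieldTheory.Balaban1983to89
open Literature.MathematicalPhysics.QuantumFieldTheory.Balaban1983to89.T3ContinuumYM3Torus
open T3PrintedRegularMinimiser (RegPr)
open T3SectALandauChart (eta eta_pos)
open B9SectCLatticeCarrier (Bond)
open B9Eq311L2Pairing (WL2)
open B11Eq111FrakG (nabla115)
open B11Eq103H1Complex (SiteL2K BondL2K)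
open Summit.QuantumFields.YangMills.Theorems.Prop7SectET3Transport (periodsT3 bondEquiv bgOfCfg)
open Summit.QuantumFields.YangMills.Theorems.Prop7SectET3HilbertLetters (W₂ toL2 toL2S toL2B DL2 DstarL2)
open Summit.QuantumFields.YangMills.Theorems.Prop7SectET3GaugeProjector (NS RS RS_RS)
open Summit.QuantumFields.YangMills.Theorems.Prop7SectET3WilsonHessian (DeltaEta DeltaEtaSlot)
open Summit.QuantumFields.YangMills.Theorems.Prop7SectET3CurvedPropagators (PosOnto GT)
open Summit.QuantumFields.YangMills.Theorems.Prop7SectET3DeltaPiPInv (GprimeP gaugeCorrP gaugeCorrP_apply)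
open Summit.QuantumFields.YangMills.Theorems.Prop7SectET3DeltaOnePInv (DeltaOneP)
open Summit.QuantumFields.YangMills.Theorems.Prop7CurrentPairingPointwise (norm_symm_DeltaEta_DL2_toL2S_apply_le_of_sup norm_symm_DstarL2_DeltaEta_toL2_apply_le)
open Summit.QuantumFields.YangMills.Theorems.Prop7GreenOneSupRowsOfLetters (GT_one_eq_six_terms)
open Summit.QuantumFields.YangMills.Theorems.Prop7FrakGSupRowsOfWords (gradient_row_frakGT_of_words norm_frakGfR_le_of_words)
open B11Eq115Space (NegSize Space115)
open Summit.QuantumFields.YangMills.Theorems.Prop7SectET3CurvedPropagators (Qk HT H1f frakGT frakGfR)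

/-! ## §0 The abstract seven-term triangle inequality -/

/-- `‖t₀ + t₁ + (t₂ − t₃) − t₄ + (t₅ − t₆)‖ ≤ Σ‖tᵢ‖` — the shape of the six-term identity. [cite: Balaban1985BackgroundPropagators, (3.138) p.423] -/
theorem norm_seven_le {E : Type*} [SeminormedAddCommGroup E] (t₀ t₁ t₂ t₃ t₄ t₅ t₆ : E) :
    ‖t₀ + t₁ + (t₂ - t₃) - t₄ + (t₅ - t₆)‖ ≤ ‖t₀‖ + ‖t₁‖ + ‖t₂‖ + ‖t₃‖ + ‖t₄‖ + ‖t₅‖ + ‖t₆‖ := by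
  have h1 := norm_add_le (t₀ + t₁ + (t₂ - t₃) - t₄) (t₅ - t₆)
  have h2 := norm_sub_le (t₀ + t₁ + (t₂ - t₃)) t₄
  have h3 := norm_add_le (t₀ + t₁) (t₂ - t₃)
  have h4 := norm_add_le t₀ t₁
  have h5 := norm_sub_le t₂ t₃
  have h6 := norm_sub_le t₅ t₆
  linarith

variable {F : T3Family} {n K : ℕ} {h : n ≤ K} {c₀ cB a : ℝ} [Fact (0 < c₀)] [Fact (0 < cB)]
  (TJ : GaugeField (F.P K) 0 (Matrix.specialUnitaryGroup (Fin 2) ℂ) → (BondL2K ℂ 3 (periodsT3 F K) c₀ W₂ →ₗ[ℂ] BondL2K ℂ 3 (periodsT3 F K) c₀ W₂))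

/-! ## §1 The gradient reader is linear -/

omit [Fact (0 < c₀)] [Fact (0 < cB)] in
/-- **THE (115)-GRADIENT READER `y ↦ ∇_{U₀}(toL2⁻¹y ∘ bondEquiv⁻¹)` IS `ℂ`-LINEAR** (`nabla115` is a linear map, `toL2⁻¹` and re-indexing along `bondEquiv⁻¹` are linear; the witness is the
composite, the identification `rfl`). [cite: Balaban1985Variational, (19) p.281, (115) p.294; Balaban1985BackgroundPropagators, (3.3) p.391] -/
theorem exists_gradReader (U₀ : GaugeField (F.P K) 0 (Matrix.specialUnitaryGroup (Fin 2) ℂ)) :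
    ∃ Γ : BondL2K ℂ 3 (periodsT3 F K) c₀ W₂ →ₗ[ℂ] (Bond 3 (periodsT3 F K) × Fin 3 → Matrix (Fin 2) (Fin 2) ℂ),
      ∀ y, Γ y = nabla115 (((F.L : ℝ)⁻¹) ^ (K - n)) (bgOfCfg F K U₀)
        (fun q : Bond 3 (periodsT3 F K) => (toL2 F K c₀).symm y ((bondEquiv F K).symm q)) :=
  ⟨nabla115 (((F.L : ℝ)⁻¹) ^ (K - n)) (bgOfCfg F K U₀)
      ∘ₗ LinearMap.funLeft ℂ (Matrix (Fin 2) (Fin 2) ℂ) (fun q : Bond 3 (periodsT3 F K) => (bondEquiv F K).symm q)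
      ∘ₗ (toL2 F K c₀).symm.toLinearMap,
    fun _ => rfl⟩

/-! ## §2 ★★★ The (115)-gradient row of `G₁` from the letters -/

/-- ★★★ **(∇1) = THE 𝔊-DOOR's `hG1` LETTER FROM VALUE-CLASS LETTERS AND TWO GRADIENT LETTERS.**  At `U₀ ∈ RegPr α`, on the classes at the slots `Δ^η` and `Δ₁ = Pᴾ†(Δ^η + T_J)Pᴾ`,
`0 ≤ a`, given: (V1)∕(Div1) the VALUE and DIVERGENCE rows of `G₁` (✓`valueDiv_rows_GTone_of_letters`' conclusion shape, constants `BV₁`, `BD₁`), (c1)(c2)(c3) the scalar-storey letters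
(FILE C's texts), (tJ)(tJd) the two `T_J` rows, **(∇0)** the (115)-gradient row of `G₀` (`∀ X s, ‖X‖_∞ ≤ s → ‖∇_{U₀}(toL2⁻¹(G₀(toL2 X)) ∘ bondEquiv⁻¹)‖ ≤ BG·s`) and **(H∇)** the Hessian row of
the chain potential (`∀ v m, ‖v‖_∞ ≤ m → ‖∇_{U₀}(toL2⁻¹(D(G′ᴾR_SG′ᴾ(toL2S v))) ∘ bondEquiv⁻¹)‖ ≤ BH·m`): for every source `A`,
`‖∇_{U₀}(toL2⁻¹(G₁(toL2 A)) ∘ bondEquiv⁻¹)‖ ≤ (BG·(1 + 4αC₁BD₁ + (4αC₁C₃(12α + C_TD) + C_T)(BV₁ + C₂BD₁)) + BH·(12α + C_TD)·(BV₁ + C₂BD₁))·‖A‖` — LINEAR bookkeeping over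
✓`GT_one_eq_six_terms`, (C-val) `4α`, (C-div) `12α`, `R_SR_S = R_S`; no window.
[cite: Balaban1985BackgroundPropagators, (3.128)–(3.131) pp.421–422, (3.134)–(3.138) pp.422–423, (3.117)–(3.119) p.419, Thm 3.12 p.423, Thm 3.13 p.426; Balaban1985Variational, (115)–(117) pp.294–295] -/
theorem gradient_row_GTone_of_letters {α : ℝ} (U₀ : GaugeField (F.P K) 0 (Matrix.specialUnitaryGroup (Fin 2) ℂ)) (hreg : RegPr F n K α U₀) (ha : 0 ≤ a)
    (hp₀ : PosOnto F n K h c₀ cB a (DeltaEtaSlot F n K c₀) U₀) (hp₁ : PosOnto F n K h c₀ cB a (DeltaOneP F n K h c₀ cB a TJ) U₀)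
    {BV₁ BD₁ C₁ C₂ C₃ CT CTD BG BH : ℝ}
    (hV1 : ∀ (A : PBond (F.P K) 0 → Matrix (Fin 2) (Fin 2) ℂ) (b : PBond (F.P K) 0),
      ‖(toL2 F K c₀).symm (GT F n K h c₀ cB a (DeltaOneP F n K h c₀ cB a TJ) U₀ (toL2 F K c₀ A)) b‖ ≤ BV₁ * ‖A‖)
    (hD1 : ∀ (A : PBond (F.P K) 0 → Matrix (Fin 2) (Fin 2) ℂ) (x : Site (F.P K) 0),
      ‖(toL2S F K c₀).symm (DstarL2 F n K c₀ U₀ (GT F n K h c₀ cB a (DeltaOneP F n K h c₀ cB a TJ) U₀ (toL2 F K c₀ A))) x‖ ≤ BD₁ * ‖A‖)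
    (hc1 : ∀ (v : Site (F.P K) 0 → Matrix (Fin 2) (Fin 2) ℂ) (m : ℝ), (∀ x, ‖v x‖ ≤ m) →
      ∀ x, ‖(toL2S F K c₀).symm (GprimeP F n K h c₀ cB a U₀ (RS F n K h c₀ cB U₀ (toL2S F K c₀ v))) x‖ ≤ C₁ * m)
    (hc2 : ∀ (v : Site (F.P K) 0 → Matrix (Fin 2) (Fin 2) ℂ) (m : ℝ), (∀ x, ‖v x‖ ≤ m) →
      ∀ b, ‖(toL2 F K c₀).symm (DL2 F n K c₀ U₀ (GprimeP F n K h c₀ cB a U₀ (RS F n K h c₀ cB U₀ (toL2S F K c₀ v)))) b‖ ≤ C₂ * m)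
    (hc3 : ∀ (v : Site (F.P K) 0 → Matrix (Fin 2) (Fin 2) ℂ) (m : ℝ), (∀ x, ‖v x‖ ≤ m) →
      ∀ x, ‖(toL2S F K c₀).symm (RS F n K h c₀ cB U₀ (GprimeP F n K h c₀ cB a U₀ (toL2S F K c₀ v))) x‖ ≤ C₃ * m)
    (hTJ : ∀ (Y : PBond (F.P K) 0 → Matrix (Fin 2) (Fin 2) ℂ) (s : ℝ), (∀ b, ‖Y b‖ ≤ s) →
      ∀ b, ‖(toL2 F K c₀).symm (TJ U₀ (toL2 F K c₀ Y)) b‖ ≤ CT * s)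
    (hTJd : ∀ (Y : PBond (F.P K) 0 → Matrix (Fin 2) (Fin 2) ℂ) (s : ℝ), (∀ b, ‖Y b‖ ≤ s) →
      ∀ x, ‖(toL2S F K c₀).symm (DstarL2 F n K c₀ U₀ (TJ U₀ (toL2 F K c₀ Y))) x‖ ≤ CTD * s)
    (hG0 : ∀ (X : PBond (F.P K) 0 → Matrix (Fin 2) (Fin 2) ℂ) (s : ℝ), (∀ b, ‖X b‖ ≤ s) →
      ‖nabla115 (((F.L : ℝ)⁻¹) ^ (K - n)) (bgOfCfg F K U₀)
          (fun q : Bond 3 (periodsT3 F K) => (toL2 F K c₀).symm (GT F n K h c₀ cB a (DeltaEtaSlot F n K c₀) U₀ (toL2 F K c₀ X)) ((bondEquiv F K).symm q))‖ ≤ BG * s)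
    (hHD : ∀ (v : Site (F.P K) 0 → Matrix (Fin 2) (Fin 2) ℂ) (m : ℝ), (∀ x, ‖v x‖ ≤ m) →
      ‖nabla115 (((F.L : ℝ)⁻¹) ^ (K - n)) (bgOfCfg F K U₀)
          (fun q : Bond 3 (periodsT3 F K) => (toL2 F K c₀).symm (DL2 F n K c₀ U₀ (GprimeP F n K h c₀ cB a U₀ (RS F n K h c₀ cB U₀
            (GprimeP F n K h c₀ cB a U₀ (toL2S F K c₀ v))))) ((bondEquiv F K).symm q))‖ ≤ BH * m)
    (A : PBond (F.P K) 0 → Matrix (Fin 2) (Fin 2) ℂ) :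
    ‖nabla115 (((F.L : ℝ)⁻¹) ^ (K - n)) (bgOfCfg F K U₀)
        (fun q : Bond 3 (periodsT3 F K) =>
          (toL2 F K c₀).symm (GT F n K h c₀ cB a (DeltaOneP F n K h c₀ cB a TJ) U₀ (toL2 F K c₀ A)) ((bondEquiv F K).symm q))‖
      ≤ (BG * (1 + 4 * α * C₁ * BD₁ + (4 * α * C₁ * C₃ * (12 * α + CTD) + CT) * (BV₁ + C₂ * BD₁))
          + BH * (12 * α + CTD) * (BV₁ + C₂ * BD₁)) * ‖A‖ := by
  obtain ⟨Γ, hΓ⟩ := exists_gradReader (n := n) (c₀ := c₀) U₀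
  -- the six-term identity (before the abbreviations)
  have h6 := GT_one_eq_six_terms TJ (h := h) (cB := cB) ha hp₀ hp₁ (toL2 F K c₀ A)
  -- the objects
  set f := toL2 F K c₀ A with hf
  set u := GT F n K h c₀ cB a (DeltaOneP F n K h c₀ cB a TJ) U₀ f with hu
  set lam₁ := GprimeP F n K h c₀ cB a U₀ (RS F n K h c₀ cB U₀ (DstarL2 F n K c₀ U₀ u)) with hlam₁
  set j := DstarL2 F n K c₀ U₀ (DeltaEta F n K c₀ U₀ (gaugeCorrP F n K h c₀ cB a U₀ u)) with hj
  set lam₂ := GprimeP F n K h c₀ cB a U₀ (RS F n K h c₀ cB U₀ (GprimeP F n K h c₀ cB a U₀ j)) with hlam₂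
  set j₃ := DstarL2 F n K c₀ U₀ (TJ U₀ (gaugeCorrP F n K h c₀ cB a U₀ u)) with hj₃
  set lam₃ := GprimeP F n K h c₀ cB a U₀ (RS F n K h c₀ cB U₀ (GprimeP F n K h c₀ cB a U₀ j₃)) with hlam₃
  set G₀ := GT F n K h c₀ cB a (DeltaEtaSlot F n K c₀) U₀ with hG₀
  -- the goal is `‖Γ u‖`
  rw [← hΓ u]
  -- Γ of the identity
  have hΓu : Γ u = Γ (G₀ f) + Γ (G₀ (DeltaEta F n K c₀ U₀ (DL2 F n K c₀ U₀ lam₁)))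
      + (Γ (DL2 F n K c₀ U₀ lam₂) - Γ (G₀ (DeltaEta F n K c₀ U₀ (DL2 F n K c₀ U₀ lam₂))))
      - Γ (G₀ (TJ U₀ (gaugeCorrP F n K h c₀ cB a U₀ u)))
      + (Γ (DL2 F n K c₀ U₀ lam₃) - Γ (G₀ (DeltaEta F n K c₀ U₀ (DL2 F n K c₀ U₀ lam₃)))) := by
    have e := congrArg Γ h6
    simpa only [map_add, map_sub] using e
  -- the readers in Hilbert-source currency
  have hread : ∀ y : BondL2K ℂ 3 (periodsT3 F K) c₀ W₂, y = toL2 F K c₀ ((toL2 F K c₀).symm y) := fun y => (LinearEquiv.apply_symm_apply _ _).symm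
  have hreadS : ∀ g : SiteL2K ℂ 3 (periodsT3 F K) c₀ W₂, g = toL2S F K c₀ ((toL2S F K c₀).symm g) := fun g => (LinearEquiv.apply_symm_apply _ _).symm
  -- (∇0) on a Hilbert-level source
  have hG0' : ∀ (y : BondL2K ℂ 3 (periodsT3 F K) c₀ W₂) (m : ℝ), (∀ b, ‖(toL2 F K c₀).symm y b‖ ≤ m) → ‖Γ (G₀ y)‖ ≤ BG * m := by
    intro y m hm
    have e := hG0 ((toL2 F K c₀).symm y) m hm
    rw [← hread y] at e
    rw [hΓ]
    exact e
  -- (V1)∕(Div1) at the source `A`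
  have hUb : ∀ b, ‖(toL2 F K c₀).symm u b‖ ≤ BV₁ * ‖A‖ := fun b => hV1 A b
  set V : Site (F.P K) 0 → Matrix (Fin 2) (Fin 2) ℂ := (toL2S F K c₀).symm (DstarL2 F n K c₀ U₀ u) with hVd
  have hVx : ∀ x, ‖V x‖ ≤ BD₁ * ‖A‖ := fun x => hD1 A x
  -- (c1)(c2) on `λ₁ = G′ᴾR_S(toL2S V)`
  have hVeq : toL2S F K c₀ V = DstarL2 F n K c₀ U₀ u := LinearEquiv.apply_symm_apply _ _
  have hlam₁V : lam₁ = GprimeP F n K h c₀ cB a U₀ (RS F n K h c₀ cB U₀ (toL2S F K c₀ V)) := by rw [hVeq]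
  have hl₁ : ∀ x, ‖(toL2S F K c₀).symm lam₁ x‖ ≤ C₁ * (BD₁ * ‖A‖) := fun x => by rw [hlam₁V]; exact hc1 V _ hVx x
  have hDl₁ : ∀ b, ‖(toL2 F K c₀).symm (DL2 F n K c₀ U₀ lam₁) b‖ ≤ C₂ * (BD₁ * ‖A‖) := fun b => by rw [hlam₁V]; exact hc2 V _ hVx b
  -- (C-val) on the defect sources `Δ^η(Dλ)`
  have hsrc : ∀ (lam : SiteL2K ℂ 3 (periodsT3 F K) c₀ W₂) (m : ℝ), (∀ x, ‖(toL2S F K c₀).symm lam x‖ ≤ m) →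
      ∀ b, ‖(toL2 F K c₀).symm (DeltaEta F n K c₀ U₀ (DL2 F n K c₀ U₀ lam)) b‖ ≤ 4 * α * m := by
    intro lam m hm b
    rw [hreadS lam]
    exact norm_symm_DeltaEta_DL2_toL2S_apply_le_of_sup U₀ hreg _ hm b
  -- `Pᴾu = u − Dλ₁` pointwise
  set Pu : PBond (F.P K) 0 → Matrix (Fin 2) (Fin 2) ℂ := (toL2 F K c₀).symm (gaugeCorrP F n K h c₀ cB a U₀ u) with hPu
  have hPu_le : ∀ b, ‖Pu b‖ ≤ BV₁ * ‖A‖ + C₂ * (BD₁ * ‖A‖) := by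
    intro b
    have e : Pu b = (toL2 F K c₀).symm u b - (toL2 F K c₀).symm (DL2 F n K c₀ U₀ lam₁) b := by
      rw [hPu, gaugeCorrP_apply, map_sub, Pi.sub_apply]
    rw [e]
    exact (norm_sub_le _ _).trans (add_le_add (hUb b) (hDl₁ b))
  have hPueq : toL2 F K c₀ Pu = gaugeCorrP F n K h c₀ cB a U₀ u := LinearEquiv.apply_symm_apply _ _
  -- (C-div) on `j = D*Δ^η(Pᴾu)`; (tJ)(tJd) on `T_J(Pᴾu)` and `j₃ = D*T_J(Pᴾu)`
  have hjle : ∀ x, ‖(toL2S F K c₀).symm j x‖ ≤ 12 * α * (BV₁ * ‖A‖ + C₂ * (BD₁ * ‖A‖)) := by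
    intro x
    rw [hj, ← hPueq]
    exact norm_symm_DstarL2_DeltaEta_toL2_apply_le U₀ hreg Pu hPu_le x
  have hTPu : ∀ b, ‖(toL2 F K c₀).symm (TJ U₀ (gaugeCorrP F n K h c₀ cB a U₀ u)) b‖ ≤ CT * (BV₁ * ‖A‖ + C₂ * (BD₁ * ‖A‖)) := fun b => by
    rw [← hPueq]; exact hTJ Pu _ hPu_le b
  have hj₃le : ∀ x, ‖(toL2S F K c₀).symm j₃ x‖ ≤ CTD * (BV₁ * ‖A‖ + C₂ * (BD₁ * ‖A‖)) := fun x => by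
    rw [hj₃, ← hPueq]; exact hTJd Pu _ hPu_le x
  -- the chains `jj ↦ R_SG′ᴾjj ↦ λ = G′ᴾR_SG′ᴾjj` through (c3)(c1), and (H∇) on `Dλ`
  have hchain : ∀ (jj : SiteL2K ℂ 3 (periodsT3 F K) c₀ W₂) (m : ℝ), (∀ x, ‖(toL2S F K c₀).symm jj x‖ ≤ m) →
      (∀ x, ‖(toL2S F K c₀).symm (GprimeP F n K h c₀ cB a U₀ (RS F n K h c₀ cB U₀ (GprimeP F n K h c₀ cB a U₀ jj))) x‖ ≤ C₁ * (C₃ * m)) ∧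
      ‖Γ (DL2 F n K c₀ U₀ (GprimeP F n K h c₀ cB a U₀ (RS F n K h c₀ cB U₀ (GprimeP F n K h c₀ cB a U₀ jj))))‖ ≤ BH * m := by
    intro jj m hm
    set Jv : Site (F.P K) 0 → Matrix (Fin 2) (Fin 2) ℂ := (toL2S F K c₀).symm jj with hJv
    have hJveq : toL2S F K c₀ Jv = jj := LinearEquiv.apply_symm_apply _ _
    have hg : ∀ x, ‖(toL2S F K c₀).symm (RS F n K h c₀ cB U₀ (GprimeP F n K h c₀ cB a U₀ jj)) x‖ ≤ C₃ * m := fun x => by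
      rw [← hJveq]; exact hc3 Jv m hm x
    set Gv : Site (F.P K) 0 → Matrix (Fin 2) (Fin 2) ℂ := (toL2S F K c₀).symm (RS F n K h c₀ cB U₀ (GprimeP F n K h c₀ cB a U₀ jj)) with hGv
    have hGveq : toL2S F K c₀ Gv = RS F n K h c₀ cB U₀ (GprimeP F n K h c₀ cB a U₀ jj) := LinearEquiv.apply_symm_apply _ _
    have hlamG : GprimeP F n K h c₀ cB a U₀ (RS F n K h c₀ cB U₀ (GprimeP F n K h c₀ cB a U₀ jj)) = GprimeP F n K h c₀ cB a U₀ (RS F n K h c₀ cB U₀ (toL2S F K c₀ Gv)) := by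
      rw [hGveq, RS_RS]
    refine ⟨fun x => ?_, ?_⟩
    · rw [hlamG]; exact hc1 Gv _ hg x
    · have e := hHD Jv m hm
      rw [hJveq] at e
      rw [hΓ]
      exact e
  obtain ⟨hl₂, hΓDl₂⟩ := hchain j (12 * α * (BV₁ * ‖A‖ + C₂ * (BD₁ * ‖A‖))) hjle
  obtain ⟨hl₃, hΓDl₃⟩ := hchain j₃ (CTD * (BV₁ * ‖A‖ + C₂ * (BD₁ * ‖A‖))) hj₃le
  -- the seven gradients
  have T0 : ‖Γ (G₀ f)‖ ≤ BG * ‖A‖ := hG0' f ‖A‖ fun b => by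
    rw [hf, LinearEquiv.symm_apply_apply]; exact norm_le_pi_norm A b
  have T1 : ‖Γ (G₀ (DeltaEta F n K c₀ U₀ (DL2 F n K c₀ U₀ lam₁)))‖ ≤ BG * (4 * α * (C₁ * (BD₁ * ‖A‖))) := hG0' _ _ (hsrc lam₁ _ hl₁)
  have T2 : ‖Γ (DL2 F n K c₀ U₀ lam₂)‖ ≤ BH * (12 * α * (BV₁ * ‖A‖ + C₂ * (BD₁ * ‖A‖))) := hΓDl₂
  have T3 : ‖Γ (G₀ (DeltaEta F n K c₀ U₀ (DL2 F n K c₀ U₀ lam₂)))‖ ≤ BG * (4 * α * (C₁ * (C₃ * (12 * α * (BV₁ * ‖A‖ + C₂ * (BD₁ * ‖A‖)))))) :=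
    hG0' _ _ (hsrc lam₂ _ hl₂)
  have T4 : ‖Γ (G₀ (TJ U₀ (gaugeCorrP F n K h c₀ cB a U₀ u)))‖ ≤ BG * (CT * (BV₁ * ‖A‖ + C₂ * (BD₁ * ‖A‖))) := hG0' _ _ hTPu
  have T5 : ‖Γ (DL2 F n K c₀ U₀ lam₃)‖ ≤ BH * (CTD * (BV₁ * ‖A‖ + C₂ * (BD₁ * ‖A‖))) := hΓDl₃
  have T6 : ‖Γ (G₀ (DeltaEta F n K c₀ U₀ (DL2 F n K c₀ U₀ lam₃)))‖ ≤ BG * (4 * α * (C₁ * (C₃ * (CTD * (BV₁ * ‖A‖ + C₂ * (BD₁ * ‖A‖)))))) :=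
    hG0' _ _ (hsrc lam₃ _ hl₃)
  -- assemble
  rw [hΓu]
  refine (norm_seven_le _ _ _ _ _ _ _).trans ?_
  have htot : BG * ‖A‖ + BG * (4 * α * (C₁ * (BD₁ * ‖A‖))) + BH * (12 * α * (BV₁ * ‖A‖ + C₂ * (BD₁ * ‖A‖)))
      + BG * (4 * α * (C₁ * (C₃ * (12 * α * (BV₁ * ‖A‖ + C₂ * (BD₁ * ‖A‖)))))) + BG * (CT * (BV₁ * ‖A‖ + C₂ * (BD₁ * ‖A‖)))
      + BH * (CTD * (BV₁ * ‖A‖ + C₂ * (BD₁ * ‖A‖))) + BG * (4 * α * (C₁ * (C₃ * (CTD * (BV₁ * ‖A‖ + C₂ * (BD₁ * ‖A‖))))))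
      = (BG * (1 + 4 * α * C₁ * BD₁ + (4 * α * C₁ * C₃ * (12 * α + CTD) + CT) * (BV₁ + C₂ * BD₁))
          + BH * (12 * α + CTD) * (BV₁ + C₂ * BD₁)) * ‖A‖ := by ring
  linarith [T0, T1, T2, T3, T4, T5, T6, htot]

/-! ## §3 End to end through the 𝔊-door with `hG1` discharged -/

section Door

variable [Fact (0 < (F.L : ℝ))] [Fact (0 < ((F.L : ℝ)⁻¹) ^ (K - n))]

omit [Fact (0 < (F.L : ℝ))] [Fact (0 < ((F.L : ℝ)⁻¹) ^ (K - n))] in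
/-- ★★ **THE DOOR's (∇) LETTER FOR `𝔊` WITH `hG1` DISCHARGED** (✓`Prop7FrakGSupRowsOfWords.gradient_row_frakGT_of_words` ∘ §2): from (V1)(Div1)(c1)(c2)(c3)(tJ)(tJd)(∇0)(H∇), ONE displayed
letter (Hess3) for the third word, the gradient row (H∇ of `H₁`) and (Qrow):
`‖∇_{U₀}(toL2⁻¹(𝔊(toL2 A)) ∘ bondEquiv⁻¹)‖ ≤ (BG₁ + M₃ + B_HG·BQ·BV₁)·‖A‖`, `BG₁` = §2's constant.
[cite: Balaban1985BackgroundPropagators, Thm 3.1 (3.42)–(3.45) pp.397–398, (3.138) p.423, (3.152)–(3.153) p.426; Balaban1985Variational, (103) p.293, (115)–(117) pp.294–295] -/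
theorem gradient_row_frakGT_of_letters {α : ℝ} (U₀ : GaugeField (F.P K) 0 (Matrix.specialUnitaryGroup (Fin 2) ℂ)) (hreg : RegPr F n K α U₀) (ha : 0 ≤ a)
    (hp₀ : PosOnto F n K h c₀ cB a (DeltaEtaSlot F n K c₀) U₀) (hp₁ : PosOnto F n K h c₀ cB a (DeltaOneP F n K h c₀ cB a TJ) U₀)
    {BV₁ BD₁ C₁ C₂ C₃ CT CTD BG BH M₃ BHG BQ : ℝ} (hBV₁ : 0 ≤ BV₁) (hBHG : 0 ≤ BHG) (hBQ : 0 ≤ BQ)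
    (hV1 : ∀ (A : PBond (F.P K) 0 → Matrix (Fin 2) (Fin 2) ℂ) (b : PBond (F.P K) 0),
      ‖(toL2 F K c₀).symm (GT F n K h c₀ cB a (DeltaOneP F n K h c₀ cB a TJ) U₀ (toL2 F K c₀ A)) b‖ ≤ BV₁ * ‖A‖)
    (hD1 : ∀ (A : PBond (F.P K) 0 → Matrix (Fin 2) (Fin 2) ℂ) (x : Site (F.P K) 0),
      ‖(toL2S F K c₀).symm (DstarL2 F n K c₀ U₀ (GT F n K h c₀ cB a (DeltaOneP F n K h c₀ cB a TJ) U₀ (toL2 F K c₀ A))) x‖ ≤ BD₁ * ‖A‖)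
    (hc1 : ∀ (v : Site (F.P K) 0 → Matrix (Fin 2) (Fin 2) ℂ) (m : ℝ), (∀ x, ‖v x‖ ≤ m) →
      ∀ x, ‖(toL2S F K c₀).symm (GprimeP F n K h c₀ cB a U₀ (RS F n K h c₀ cB U₀ (toL2S F K c₀ v))) x‖ ≤ C₁ * m)
    (hc2 : ∀ (v : Site (F.P K) 0 → Matrix (Fin 2) (Fin 2) ℂ) (m : ℝ), (∀ x, ‖v x‖ ≤ m) →
      ∀ b, ‖(toL2 F K c₀).symm (DL2 F n K c₀ U₀ (GprimeP F n K h c₀ cB a U₀ (RS F n K h c₀ cB U₀ (toL2S F K c₀ v)))) b‖ ≤ C₂ * m)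
    (hc3 : ∀ (v : Site (F.P K) 0 → Matrix (Fin 2) (Fin 2) ℂ) (m : ℝ), (∀ x, ‖v x‖ ≤ m) →
      ∀ x, ‖(toL2S F K c₀).symm (RS F n K h c₀ cB U₀ (GprimeP F n K h c₀ cB a U₀ (toL2S F K c₀ v))) x‖ ≤ C₃ * m)
    (hTJ : ∀ (Y : PBond (F.P K) 0 → Matrix (Fin 2) (Fin 2) ℂ) (s : ℝ), (∀ b, ‖Y b‖ ≤ s) →
      ∀ b, ‖(toL2 F K c₀).symm (TJ U₀ (toL2 F K c₀ Y)) b‖ ≤ CT * s)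
    (hTJd : ∀ (Y : PBond (F.P K) 0 → Matrix (Fin 2) (Fin 2) ℂ) (s : ℝ), (∀ b, ‖Y b‖ ≤ s) →
      ∀ x, ‖(toL2S F K c₀).symm (DstarL2 F n K c₀ U₀ (TJ U₀ (toL2 F K c₀ Y))) x‖ ≤ CTD * s)
    (hG0 : ∀ (X : PBond (F.P K) 0 → Matrix (Fin 2) (Fin 2) ℂ) (s : ℝ), (∀ b, ‖X b‖ ≤ s) →
      ‖nabla115 (((F.L : ℝ)⁻¹) ^ (K - n)) (bgOfCfg F K U₀)
          (fun q : Bond 3 (periodsT3 F K) => (toL2 F K c₀).symm (GT F n K h c₀ cB a (DeltaEtaSlot F n K c₀) U₀ (toL2 F K c₀ X)) ((bondEquiv F K).symm q))‖ ≤ BG * s)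
    (hHD : ∀ (v : Site (F.P K) 0 → Matrix (Fin 2) (Fin 2) ℂ) (m : ℝ), (∀ x, ‖v x‖ ≤ m) →
      ‖nabla115 (((F.L : ℝ)⁻¹) ^ (K - n)) (bgOfCfg F K U₀)
          (fun q : Bond 3 (periodsT3 F K) => (toL2 F K c₀).symm (DL2 F n K c₀ U₀ (GprimeP F n K h c₀ cB a U₀ (RS F n K h c₀ cB U₀
            (GprimeP F n K h c₀ cB a U₀ (toL2S F K c₀ v))))) ((bondEquiv F K).symm q))‖ ≤ BH * m)
    (h3 : ∀ A : PBond (F.P K) 0 → Matrix (Fin 2) (Fin 2) ℂ,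
      ‖nabla115 (((F.L : ℝ)⁻¹) ^ (K - n)) (bgOfCfg F K U₀)
          (fun q : Bond 3 (periodsT3 F K) => (toL2 F K c₀).symm (DL2 F n K c₀ U₀ (GprimeP F n K h c₀ cB a U₀ (RS F n K h c₀ cB U₀
            (DstarL2 F n K c₀ U₀ (GT F n K h c₀ cB a (DeltaOneP F n K h c₀ cB a TJ) U₀ (toL2 F K c₀ A)))))) ((bondEquiv F K).symm q))‖ ≤ M₃ * ‖A‖)
    (hHG : ∀ Y : PBond (F.P n) 0 → Matrix (Fin 2) (Fin 2) ℂ,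
      ‖nabla115 (((F.L : ℝ)⁻¹) ^ (K - n)) (bgOfCfg F K U₀)
          (fun q : Bond 3 (periodsT3 F K) => (toL2 F K c₀).symm (HT F n K h c₀ cB a (DeltaOneP F n K h c₀ cB a TJ) U₀ (toL2B F n cB Y)) ((bondEquiv F K).symm q))‖ ≤ BHG * ‖Y‖)
    (hQ : ∀ (u : BondL2K ℂ 3 (periodsT3 F K) c₀ W₂) (s : ℝ), (∀ b, ‖(toL2 F K c₀).symm u b‖ ≤ s) →
      ∀ c, ‖(toL2B F n cB).symm (Qk F n K h c₀ cB U₀ u) c‖ ≤ BQ * s)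
    (A : PBond (F.P K) 0 → Matrix (Fin 2) (Fin 2) ℂ) :
    ‖nabla115 (((F.L : ℝ)⁻¹) ^ (K - n)) (bgOfCfg F K U₀)
        (fun q : Bond 3 (periodsT3 F K) =>
          (toL2 F K c₀).symm (frakGT F n K h c₀ cB a (DeltaOneP F n K h c₀ cB a TJ) U₀ (toL2 F K c₀ A)) ((bondEquiv F K).symm q))‖
      ≤ ((BG * (1 + 4 * α * C₁ * BD₁ + (4 * α * C₁ * C₃ * (12 * α + CTD) + CT) * (BV₁ + C₂ * BD₁))
          + BH * (12 * α + CTD) * (BV₁ + C₂ * BD₁)) + M₃ + BHG * BQ * BV₁) * ‖A‖ :=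
  gradient_row_frakGT_of_words F n K h c₀ cB a TJ U₀ ha hp₁ hBV₁ hBHG hBQ hV1
    (gradient_row_GTone_of_letters TJ U₀ hreg ha hp₀ hp₁ hV1 hD1 hc1 hc2 hc3 hTJ hTJd hG0 hHD) h3 hHG hQ A

/-- ★★★ **`norm_G`'s INEQUALITY AT THE SLOT `Δ₁ = Pᴾ†(Δ^η + T_J)Pᴾ` WITH THE `G₁`-GRADIENT DISCHARGED** (✓`Prop7FrakGSupRowsOfWords.norm_frakGfR_le_of_words` ∘ §2):
`‖frakGfR … (DeltaOneP T_J) U₀ f‖ ≤ max M_V M_∇ · ‖f‖` with `M_V = BV₁ + C₂·BD₁ + B_H·BQ·BV₁`, `M_∇ = BG₁ + M₃ + B_H·BQ·BV₁`, from (V1)(Div1)(c1)(c2)(c3)(tJ)(tJd)(Qrow)(∇0)(H∇),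
ONE displayed letter (Hess3), and the `norm_H₁` text `∀ B, ‖H1f … U₀ B‖ ≤ B_H‖B‖` — the S-event census line `norm_G ⟸ norm_H₁ ∧ {value letters} ∧ (Qrow) ∧ (∇0) ∧ (H∇) ∧ STOREY-H`.
[cite: Balaban1985Variational, (117) p.295; Balaban1985BackgroundPropagators, Thm 3.13 p.426, (3.130)–(3.131) pp.421–422, (3.138) p.423, (3.152)–(3.153) p.426] -/
theorem norm_frakGfR_le_of_letters {α : ℝ} (U₀ : GaugeField (F.P K) 0 (Matrix.specialUnitaryGroup (Fin 2) ℂ)) (hreg : RegPr F n K α U₀) (ha : 0 ≤ a)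
    (hp₀ : PosOnto F n K h c₀ cB a (DeltaEtaSlot F n K c₀) U₀) (hp₁ : PosOnto F n K h c₀ cB a (DeltaOneP F n K h c₀ cB a TJ) U₀)
    {BV₁ BD₁ C₁ C₂ C₃ CT CTD BG BH M₃ BHq BQ : ℝ} (hBV₁ : 0 ≤ BV₁) (hBD₁ : 0 ≤ BD₁) (hC₂ : 0 ≤ C₂) (hBHq : 0 ≤ BHq) (hBQ : 0 ≤ BQ)
    (hV1 : ∀ (A : PBond (F.P K) 0 → Matrix (Fin 2) (Fin 2) ℂ) (b : PBond (F.P K) 0),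
      ‖(toL2 F K c₀).symm (GT F n K h c₀ cB a (DeltaOneP F n K h c₀ cB a TJ) U₀ (toL2 F K c₀ A)) b‖ ≤ BV₁ * ‖A‖)
    (hD1 : ∀ (A : PBond (F.P K) 0 → Matrix (Fin 2) (Fin 2) ℂ) (x : Site (F.P K) 0),
      ‖(toL2S F K c₀).symm (DstarL2 F n K c₀ U₀ (GT F n K h c₀ cB a (DeltaOneP F n K h c₀ cB a TJ) U₀ (toL2 F K c₀ A))) x‖ ≤ BD₁ * ‖A‖)
    (hc1 : ∀ (v : Site (F.P K) 0 → Matrix (Fin 2) (Fin 2) ℂ) (m : ℝ), (∀ x, ‖v x‖ ≤ m) →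
      ∀ x, ‖(toL2S F K c₀).symm (GprimeP F n K h c₀ cB a U₀ (RS F n K h c₀ cB U₀ (toL2S F K c₀ v))) x‖ ≤ C₁ * m)
    (hc2 : ∀ (v : Site (F.P K) 0 → Matrix (Fin 2) (Fin 2) ℂ) (m : ℝ), (∀ x, ‖v x‖ ≤ m) →
      ∀ b, ‖(toL2 F K c₀).symm (DL2 F n K c₀ U₀ (GprimeP F n K h c₀ cB a U₀ (RS F n K h c₀ cB U₀ (toL2S F K c₀ v)))) b‖ ≤ C₂ * m)
    (hc3 : ∀ (v : Site (F.P K) 0 → Matrix (Fin 2) (Fin 2) ℂ) (m : ℝ), (∀ x, ‖v x‖ ≤ m) →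
      ∀ x, ‖(toL2S F K c₀).symm (RS F n K h c₀ cB U₀ (GprimeP F n K h c₀ cB a U₀ (toL2S F K c₀ v))) x‖ ≤ C₃ * m)
    (hTJ : ∀ (Y : PBond (F.P K) 0 → Matrix (Fin 2) (Fin 2) ℂ) (s : ℝ), (∀ b, ‖Y b‖ ≤ s) →
      ∀ b, ‖(toL2 F K c₀).symm (TJ U₀ (toL2 F K c₀ Y)) b‖ ≤ CT * s)
    (hTJd : ∀ (Y : PBond (F.P K) 0 → Matrix (Fin 2) (Fin 2) ℂ) (s : ℝ), (∀ b, ‖Y b‖ ≤ s) →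
      ∀ x, ‖(toL2S F K c₀).symm (DstarL2 F n K c₀ U₀ (TJ U₀ (toL2 F K c₀ Y))) x‖ ≤ CTD * s)
    (hQ : ∀ (u : BondL2K ℂ 3 (periodsT3 F K) c₀ W₂) (s : ℝ), (∀ b, ‖(toL2 F K c₀).symm u b‖ ≤ s) →
      ∀ c, ‖(toL2B F n cB).symm (Qk F n K h c₀ cB U₀ u) c‖ ≤ BQ * s)
    (hG0 : ∀ (X : PBond (F.P K) 0 → Matrix (Fin 2) (Fin 2) ℂ) (s : ℝ), (∀ b, ‖X b‖ ≤ s) →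
      ‖nabla115 (((F.L : ℝ)⁻¹) ^ (K - n)) (bgOfCfg F K U₀)
          (fun q : Bond 3 (periodsT3 F K) => (toL2 F K c₀).symm (GT F n K h c₀ cB a (DeltaEtaSlot F n K c₀) U₀ (toL2 F K c₀ X)) ((bondEquiv F K).symm q))‖ ≤ BG * s)
    (hHD : ∀ (v : Site (F.P K) 0 → Matrix (Fin 2) (Fin 2) ℂ) (m : ℝ), (∀ x, ‖v x‖ ≤ m) →
      ‖nabla115 (((F.L : ℝ)⁻¹) ^ (K - n)) (bgOfCfg F K U₀)
          (fun q : Bond 3 (periodsT3 F K) => (toL2 F K c₀).symm (DL2 F n K c₀ U₀ (GprimeP F n K h c₀ cB a U₀ (RS F n K h c₀ cB U₀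
            (GprimeP F n K h c₀ cB a U₀ (toL2S F K c₀ v))))) ((bondEquiv F K).symm q))‖ ≤ BH * m)
    (h3 : ∀ A : PBond (F.P K) 0 → Matrix (Fin 2) (Fin 2) ℂ,
      ‖nabla115 (((F.L : ℝ)⁻¹) ^ (K - n)) (bgOfCfg F K U₀)
          (fun q : Bond 3 (periodsT3 F K) => (toL2 F K c₀).symm (DL2 F n K c₀ U₀ (GprimeP F n K h c₀ cB a U₀ (RS F n K h c₀ cB U₀
            (DstarL2 F n K c₀ U₀ (GT F n K h c₀ cB a (DeltaOneP F n K h c₀ cB a TJ) U₀ (toL2 F K c₀ A)))))) ((bondEquiv F K).symm q))‖ ≤ M₃ * ‖A‖)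
    (hnormH : ∀ B : PBond (F.P n) 0 → Matrix (Fin 2) (Fin 2) ℂ, ‖H1f F n K h c₀ cB a (DeltaOneP F n K h c₀ cB a TJ) U₀ B‖ ≤ BHq * ‖B‖)
    (f : NegSize (F.L : ℝ) (((F.L : ℝ)⁻¹) ^ (K - n)) (fun _ : Bond 3 (periodsT3 F K) => K - n) 3 (Matrix (Fin 2) (Fin 2) ℂ)) :
    ‖frakGfR F n K h c₀ cB a (DeltaOneP F n K h c₀ cB a TJ) U₀ f‖
      ≤ max (BV₁ + C₂ * BD₁ + BHq * BQ * BV₁)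
          ((BG * (1 + 4 * α * C₁ * BD₁ + (4 * α * C₁ * C₃ * (12 * α + CTD) + CT) * (BV₁ + C₂ * BD₁))
            + BH * (12 * α + CTD) * (BV₁ + C₂ * BD₁)) + M₃ + BHq * BQ * BV₁) * ‖f‖ :=
  norm_frakGfR_le_of_words F n K h c₀ cB a TJ U₀ ha hp₁ hBV₁ hBD₁ hC₂ hBHq hBQ hV1 hD1 hc2 hQ
    (gradient_row_GTone_of_letters TJ U₀ hreg ha hp₀ hp₁ hV1 hD1 hc1 hc2 hc3 hTJ hTJd hG0 hHD) h3 hnormH f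

end Door

end Summit.QuantumFields.YangMills.Theorems.Prop7GreenOneGradientRowOfLetters

end
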